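import Summits.KontsevichZagierPeriods.KontsevichZagierPeriods.Theorems.NormalFormPrinciple.Negative.WindowInvariant
import Summits.KontsevichZagierPeriods.KontsevichZagierPeriods.Theorems.SymplecticScissorsRealOnePeriodRelationsStubSaPathSubsetAux

/-!
# Crux `HurwitzMicroSectors.NormalFormPrinciple` (stmt-KontsevichZagierPeriods-3869) — negative side III:
the arctangent reflection pair — a CoV-free non-relation WITH an algebraic shadow

Landed copy of the witness part of §4.3 of `Cruxes/NormalFormPrinciple/Disproof.lean` (cdisprove,
2026-08-16). `arctanRep lo hi = [[lo,hi] ⊂ ℝ¹, 1/(1+t²)]` is KZ-rational of value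
`arctan hi − arctan lo`; the reflection pair `r₊ = arctanRep 0 1`, `r₋ = arctanRep (−1) 0` has equal
values `π/4` and windowed values `π/4`, `0`, so `Λcov (r₊ − r₋) = π/4 mod ℚ̄ ≠ 0` (Lindemann,
`transcendental_pi_holds`): `[r₊] − [r₋] ∉ covFreeRelations` (`arctan_pair_not_mem_covFreeRelations`).
Both representations are ONE-dimensional, so `[r₊] − [r₋]` HAS an algebraic shadow
(`StuffleInKZ.Negative.hasAlgShadow_of_dim_one`): the windowed invariant separates a kernel element
that the algebraic shadow cannot (`exists_kernel_algShadow_not_mem_covFreeRelations`) — the shadow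
does not characterise `covFreeRelations`. References: [KontsevichZagier2001, §1.1–1.2]; Lindemann 1882.
-/

noncomputable section

set_option linter.dupNamespace false

open MeasureTheory Set intervalIntegral
open Literature.NumberTheory.Transcendental Literature.NumberTheory.Transcendental.KZ
open Literature.ModelTheory.ExponentialFields (IsSemialgebraic)

namespace Summit.KontsevichZagierPeriods.HurwitzMicroSectors.NormalFormPrinciple.Negative

open Summit.KontsevichZagierPeriods.SymplecticScissors.RealOnePeriodRelations.SaPathSubset
  (isSemialgebraic_slab)
open Summit.KontsevichZagierPeriods.Theorems.StuffleInKZ.Negative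
  (covFreeRelations HasAlgShadow hasAlgShadow_of_dim_one)

variable {n m : ℕ}

/-! ## The arctangent representations -/

/-- `∫_{[lo,hi]} dt/(1+t²)` as a RATIONAL integral representation on `ℝ¹`. -/
def arctanRep (lo hi : ℚ) : IntegralRep 1 :=
  IntegralRep.ofRational {z : Fin 1 → ℝ | z 0 ∈ Icc (lo : ℝ) hi} 1 (1 + MvPolynomial.X 0 ^ 2)
    (isSemialgebraic_slab lo hi)
    (fun z _ => by
      have : (0:ℝ) < 1 + z 0 ^ 2 := by positivity
      simp only [map_add, map_one, map_pow, MvPolynomial.aeval_X]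
      exact this.ne')
    (by
      have hg : Continuous (fun t : ℝ => 1 / (1 + t ^ 2)) := by
        refine continuous_const.div (by fun_prop) fun t => ?_
        positivity
      have := (hg.integrableOn_Icc (μ := volume) (a := (lo:ℝ)) (b := hi))
      refine ((integrableOn_fin_one (g := fun z : Fin 1 → ℝ => 1 / (1 + z 0 ^ 2))
        (T := Icc (lo:ℝ) hi)).mpr this).congr_fun (fun z _ => ?_)
        ((isSemialgebraic_slab lo hi).measurableSet_holds)
      simp [MvPolynomial.aeval_X] )

/-- The domain of `arctanRep lo hi` is `[lo, hi] ⊂ ℝ¹`. -/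
theorem arctanRep_domain (lo hi : ℚ) :
    (arctanRep lo hi).domain = {z : Fin 1 → ℝ | z 0 ∈ Icc (lo : ℝ) hi} := rfl

/-- The integrand of `arctanRep lo hi` is `1/(1+t²)`. -/
theorem arctanRep_integrand (lo hi : ℚ) (z : Fin 1 → ℝ) :
    (arctanRep lo hi).integrand z = 1 / (1 + z 0 ^ 2) := by
  simp [arctanRep]

/-- `arctanRep lo hi` has KZ's rational shape. -/
theorem isRational_arctanRep (lo hi : ℚ) : (arctanRep lo hi).IsRational :=
  IntegralRep.isRational_ofRational _ _ _ _ _ _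

/-- `value (arctanRep lo hi) = arctan hi − arctan lo` (`integral_one_div_one_add_sq`). -/
theorem value_arctanRep {lo hi : ℚ} (h : (lo:ℝ) ≤ hi) :
    (arctanRep lo hi).value = Real.arctan hi - Real.arctan lo := by
  rw [IntegralRep.value, arctanRep_domain]
  simp_rw [arctanRep_integrand]
  rw [setIntegral_fin_one (fun z : Fin 1 → ℝ => 1 / (1 + z 0 ^ 2)) (Icc (lo:ℝ) hi)]
  simp only
  rw [integral_Icc_eq_integral_Ioc, ← integral_of_le h, integral_one_div_one_add_sq]

/-- The two arctangent representations have the same value (`π/4`). -/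
theorem value_arctanRep_eq : (arctanRep 0 1).value = (arctanRep (-1) 0).value := by
  rw [value_arctanRep (by norm_num), value_arctanRep (by norm_num)]
  push_cast
  rw [Real.arctan_neg, Real.arctan_zero, Real.arctan_one]
  ring

/-! ## The windowed values and the separation -/

/-- The windowed value of `[[0,1], 1/(1+t²)]` is `π/4`. -/
theorem windowEval_arctanRep_zero_one : windowEval (of (arctanRep 0 1)) = Real.pi / 4 := by
  rw [windowEval_of, arctanRep_domain, wnd_succ]
  simp_rw [arctanRep_integrand]
  have hset : ({z : Fin 1 → ℝ | z 0 ∈ Icc ((0:ℚ):ℝ) (1:ℚ)} ∩ {x | x 0 ∈ Ioo (0:ℝ) 1}) =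
      {z : Fin 1 → ℝ | z 0 ∈ Ioo (0:ℝ) 1} := by
    ext z
    simp only [Rat.cast_zero, Rat.cast_one, mem_inter_iff, mem_setOf_eq, mem_Icc, mem_Ioo]
    constructor
    · rintro ⟨-, h⟩; exact h
    · rintro ⟨h1, h2⟩; exact ⟨⟨h1.le, h2.le⟩, h1, h2⟩
  rw [hset, setIntegral_fin_one (fun z : Fin 1 → ℝ => 1 / (1 + z 0 ^ 2)) (Ioo (0:ℝ) 1)]
  simp only
  rw [← integral_Ioc_eq_integral_Ioo, ← integral_of_le zero_le_one, integral_one_div_one_add_sq,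
    Real.arctan_one, Real.arctan_zero, sub_zero]

/-- The windowed value of `[[−1,0], 1/(1+t²)]` is `0` (the window misses the domain). -/
theorem windowEval_arctanRep_neg_one_zero : windowEval (of (arctanRep (-1) 0)) = 0 := by
  rw [windowEval_of, arctanRep_domain, wnd_succ]
  have hset : ({z : Fin 1 → ℝ | z 0 ∈ Icc ((-1:ℚ):ℝ) (0:ℚ)} ∩ {x | x 0 ∈ Ioo (0:ℝ) 1}) = ∅ := by
    ext z
    simp only [Rat.cast_neg, Rat.cast_one, Rat.cast_zero, mem_inter_iff, mem_setOf_eq, mem_Icc,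
      mem_Ioo, mem_empty_iff_false, iff_false, not_and, not_lt, and_imp]
    intro _ h2 h3
    linarith
  rw [hset, Measure.restrict_empty, integral_zero_measure]

/-- `π/4` is not algebraic (Lindemann, `transcendental_pi_holds`). -/
theorem pi_div_four_not_mem_algReal : Real.pi / 4 ∉ algReal := by
  intro h
  rw [mem_algReal] at h
  have h4 : IsAlgebraic ℚ ((4 : ℚ) : ℝ) := isAlgebraic_algebraMap (4 : ℚ)
  have hpi : IsAlgebraic ℚ (((4:ℚ):ℝ) * (Real.pi / 4)) := h4.mul h
  have : ((4:ℚ):ℝ) * (Real.pi / 4) = Real.pi := by push_cast; ring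
  rw [this] at hpi
  exact transcendental_pi_holds hpi

/-- `Λcov` separates the two arctangent representations. -/
theorem Λcov_witness_ne_zero : Λcov (of (arctanRep 0 1) - of (arctanRep (-1) 0)) ≠ 0 := by
  rw [Ne, Λcov_eq_zero_iff, map_sub, windowEval_arctanRep_zero_one,
    windowEval_arctanRep_neg_one_zero, sub_zero]
  exact pi_div_four_not_mem_algReal

/-- **The arctangent reflection pair is not CoV-free-related**: `[r₊] − [r₋] ∉ covFreeRelations`
although both are rational of value `π/4` (they differ by the reflection `t ↦ −t`, one rule-2 move
in dimension one). -/
theorem arctan_pair_not_mem_covFreeRelations :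
    of (arctanRep 0 1) - of (arctanRep (-1) 0) ∉ covFreeRelations := fun h =>
  Λcov_witness_ne_zero (covFreeRelations_le_ker_Λcov h)

/-- The pair is a kernel element: `eval ([r₊] − [r₋]) = 0`. -/
theorem eval_arctan_pair : eval (of (arctanRep 0 1) - of (arctanRep (-1) 0)) = 0 := by
  rw [map_sub, eval_of, eval_of, value_arctanRep_eq, sub_self]

/-- **…yet it HAS an algebraic shadow** (both representations are one-dimensional, tree
`StuffleInKZ.Negative.hasAlgShadow_of_dim_one`): the algebraic-shadow invariant does not see it. -/
theorem hasAlgShadow_arctan_pair : HasAlgShadow (of (arctanRep 0 1) - of (arctanRep (-1) 0)) := by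
  rw [sub_eq_add_neg]
  exact (hasAlgShadow_of_dim_one (arctanRep 0 1)).add (hasAlgShadow_of_dim_one (arctanRep (-1) 0)).neg

/-- **The algebraic shadow does not characterise `covFreeRelations`**: there is a kernel element with
an algebraic shadow outside the CoV-free closure (separated by the arithmetic invariant `Λcov`). -/
theorem exists_kernel_algShadow_not_mem_covFreeRelations :
    ∃ c : FormalRep, eval c = 0 ∧ HasAlgShadow c ∧ c ∉ covFreeRelations :=
  ⟨_, eval_arctan_pair, hasAlgShadow_arctan_pair, arctan_pair_not_mem_covFreeRelations⟩

end Summit.KontsevichZagierPeriods.HurwitzMicroSectors.NormalFormPrinciple.Negative
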